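import Literature.NumberTheory.Automorphic.QuaternionAlgebraStructure
import Mathlib.Algebra.Group.Submonoid.Units
import HarnessLib

/-!
# Centralisers in a quaternion division algebra: `C_D(u) = K[u]`, a quadratic subfield
(Vignéras, *Arithmétique des algèbres de quaternions*, LNM 800 (1980), Ch. I §1–§2; Gelbart,
*Automorphic forms on adele groups* (1975), Remark 9.23: the regular elements of `D^×`)

Topic `NumberTheory/Automorphic`; theorems only, building on `QuaternionAlgebraStructure`
(commutative subalgebras of a central division algebra of dimension `4` have dimension `≤ 2`, and
an element of such a subalgebra is a `K`-linear combination of `1` and any of its non-scalar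
elements). For a central `K`-algebra `D` of dimension `4` in which every non-zero element is
invertible, and `u ∈ D ∖ K`:

* `Algebra.adjoin_singleton_comm` — `K[u]` is commutative;
* `Subalgebra.centralizer_singleton_eq_adjoin` — **the centraliser of `u` is `K[u]`**
  (`w` commuting with `u` lies in the commutative subalgebra `K[u, w]` of dimension `≤ 2`, hence
  in `K + K u`);
* `finrank_adjoin_singleton_eq_two` — `dim_K K[u] = 2`;
* `adjoin_singleton_isField` — `K[u]` is a field (a finite-dimensional commutative domain);
* `inv_mem_adjoin_singleton` — `K[u]` is closed under inverses in `D`;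
* `Subgroup.centralizer_units_singleton_eq` — **in `D^×` the centraliser of a non-central `γ`
  is the unit group `K[γ]^×`** (as the subgroup `(K[γ]).toSubmonoid.units` of `D^×`).

These are the algebraic facts behind "for `γ ∉ Z`, `G_γ = K(γ)^×` is a maximal torus" in the
trace formula for `D^×` (Gelbart (1975), Remark 9.23; Jacquet–Langlands §16); part of the inline
(D-0026) decomposition of
`Literature.NumberTheory.Automorphic.strong_multiplicity_one_quaternionUnits`.

## References

* M.-F. Vignéras, *Arithmétique des algèbres de quaternions*, LNM 800 (1980), Ch. I §1
  (`L = K(h)` for `h ∉ K` is a quadratic commutative subfield), §2 Cor. 2.2 [VignerasLNM800].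
* S. Gelbart, *Automorphic forms on adele groups* (1975), Remark 9.23 [Gelbart1975].
-/

noncomputable section

open Module

namespace Literature.NumberTheory.Automorphic

section Centralizer

variable {K : Type*} {D : Type*} [Field K] [Ring D] [Algebra K D]

/-- `K[u]` is commutative (`Algebra.adjoin_pair_comm_of_commute` with `w = u`). Deliberate
dot-notation extension of Mathlib's `Algebra` namespace, inside `Literature.Automorphic`.
[folklore] -/
theorem Algebra.adjoin_singleton_comm (u : D) :
    ∀ x ∈ Algebra.adjoin K {u}, ∀ y ∈ Algebra.adjoin K {u}, x * y = y * x := by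
  have h := Algebra.adjoin_pair_comm_of_commute (K := K) (Commute.refl u)
  rwa [Set.pair_eq_singleton] at h

/-- `K[u] ≤ C_D(u)`: polynomials in `u` commute with `u`. [folklore] -/
theorem Algebra.adjoin_singleton_le_centralizer (u : D) :
    Algebra.adjoin K {u} ≤ Subalgebra.centralizer K ({u} : Set D) := by
  rw [Algebra.adjoin_le_iff]
  intro x hx
  rw [Set.mem_singleton_iff] at hx
  subst hx
  rw [SetLike.mem_coe, Subalgebra.mem_centralizer_iff]
  intro g hg
  rw [Set.mem_singleton_iff] at hg
  subst hg
  rfl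

variable [Algebra.IsCentral K D]

/-- **The centraliser of a non-scalar element of a quaternion division algebra is `K[u]`**
(Vignéras I §1: for `h ∉ K`, `K(h)` is a maximal commutative subfield; here for a central
`K`-algebra of dimension `4` with all non-zero elements invertible). Proof: if `w` commutes with
`u` then `K[u, w]` is commutative, hence of dimension `≤ 2`
(`Subalgebra.finrank_le_two_of_comm`), so `w ∈ K + K u ⊆ K[u]`
(`Subalgebra.exists_eq_add_smul_of_finrank_le_two`). Deliberate dot-notation extension of
Mathlib's `Subalgebra` namespace. [cite: VignerasLNM800, Ch. I §1] -/
theorem Subalgebra.centralizer_singleton_eq_adjoin (hD : ∀ x : D, x ≠ 0 → IsUnit x)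
    (h4 : finrank K D = 4) {u : D} (hu : u ∉ (⊥ : Subalgebra K D)) :
    Subalgebra.centralizer K ({u} : Set D) = Algebra.adjoin K {u} := by
  haveI : Nontrivial D := Module.nontrivial_of_finrank_pos (R := K) (by omega)
  haveI : FiniteDimensional K D := Module.finite_of_finrank_pos (by omega)
  refine le_antisymm (fun w hw => ?_) (Algebra.adjoin_singleton_le_centralizer u)
  rw [Subalgebra.mem_centralizer_iff] at hw
  have hc : Commute u w := hw u rfl
  set S := Algebra.adjoin K {u, w} with hS
  have hSc := Algebra.adjoin_pair_comm_of_commute (K := K) hc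
  have huS : u ∈ S := Algebra.subset_adjoin (by simp)
  have hwS : w ∈ S := Algebra.subset_adjoin (by simp)
  obtain ⟨p, q, hpq⟩ := Subalgebra.exists_eq_add_smul_of_finrank_le_two S
    (Subalgebra.finrank_le_two_of_comm hD h4 S hSc) huS hwS hu
  rw [hpq]
  exact Subalgebra.add_mem _ (Subalgebra.algebraMap_mem _ p)
    (Subalgebra.smul_mem _ (Algebra.self_mem_adjoin_singleton K u) q)

/-- **`dim_K K[u] = 2` for `u ∉ K`** (a commutative subalgebra has dimension `≤ 2`, and `K[u]`
strictly contains `K`). [cite: VignerasLNM800, Ch. I §1] -/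
theorem finrank_adjoin_singleton_eq_two (hD : ∀ x : D, x ≠ 0 → IsUnit x)
    (h4 : finrank K D = 4) {u : D} (hu : u ∉ (⊥ : Subalgebra K D)) :
    finrank K (Algebra.adjoin K {u}) = 2 := by
  haveI : Nontrivial D := Module.nontrivial_of_finrank_pos (R := K) (by omega)
  haveI : FiniteDimensional K D := Module.finite_of_finrank_pos (by omega)
  have hle := Subalgebra.finrank_le_two_of_comm hD h4 _ (Algebra.adjoin_singleton_comm (K := K) u)
  have hlt : (⊥ : Subalgebra K D) < Algebra.adjoin K {u} :=
    lt_of_le_of_ne bot_le fun h => hu (h ▸ Algebra.self_mem_adjoin_singleton K u)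
  have h1 : finrank K (⊥ : Subalgebra K D) = 1 := Subalgebra.finrank_bot
  have h2 : finrank K (Subalgebra.toSubmodule (⊥ : Subalgebra K D)) <
      finrank K (Subalgebra.toSubmodule (Algebra.adjoin K {u})) :=
    Submodule.finrank_lt_finrank_of_lt (Subalgebra.toSubmodule.lt_iff_lt.2 hlt)
  rw [Subalgebra.finrank_toSubmodule, Subalgebra.finrank_toSubmodule, h1] at h2
  omega

omit [Algebra.IsCentral K D] in
/-- **`K[u]` is a field** in a finite-dimensional algebra all of whose non-zero elements are
invertible (a finite-dimensional commutative domain). [folklore] -/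
theorem adjoin_singleton_isField (hD : ∀ x : D, x ≠ 0 → IsUnit x) [Nontrivial D]
    [FiniteDimensional K D] (u : D) : IsField (Algebra.adjoin K {u}) := by
  haveI := noZeroDivisors_of_forall_isUnit hD
  letI : CommRing (Algebra.adjoin K {u}) :=
    { (inferInstance : Ring (Algebra.adjoin K {u})) with
      mul_comm := fun x y => Subtype.ext (Algebra.adjoin_singleton_comm (K := K) u x x.2 y y.2) }
  haveI : IsDomain (Algebra.adjoin K {u}) := NoZeroDivisors.to_isDomain _
  haveI : IsArtinianRing (Algebra.adjoin K {u}) := IsArtinianRing.of_finite K _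
  exact (IsArtinianRing.isField_of_isDomain (Algebra.adjoin K {u}))

omit [Algebra.IsCentral K D] in
/-- **`K[u]` is closed under inverses in `D`**: for a unit `x` of `D` lying in `K[u]`, `x⁻¹ ∈ K[u]`
(the inverse in the field `K[u]` is the inverse in `D`). [folklore] -/
theorem inv_mem_adjoin_singleton (hD : ∀ x : D, x ≠ 0 → IsUnit x) [Nontrivial D]
    [FiniteDimensional K D] (u : D) {x : Dˣ} (hx : (x : D) ∈ Algebra.adjoin K {u}) :
    ((x⁻¹ : Dˣ) : D) ∈ Algebra.adjoin K {u} := by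
  have hF := adjoin_singleton_isField (K := K) hD u
  have hx0 : (⟨(x : D), hx⟩ : Algebra.adjoin K {u}) ≠ 0 := by
    intro h
    have h' : (x : D) = 0 := congrArg Subtype.val h
    exact x.ne_zero h'
  obtain ⟨y, hy⟩ := hF.mul_inv_cancel hx0
  have hy' : (x : D) * (y : D) = 1 := congrArg Subtype.val hy
  have : ((x⁻¹ : Dˣ) : D) = (y : D) := by
    rw [← mul_one ((x⁻¹ : Dˣ) : D), ← hy', ← mul_assoc, Units.inv_mul, one_mul]
  rw [this]
  exact y.2

/-- **In `D^×` the centraliser of a non-central element is `K[γ]^×`** (Gelbart (1975),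
Remark 9.23: the regular elements of `D^×` and their tori `K(γ)^×`): for `γ ∈ D^×` with
`γ ∉ K`, `C_{D^×}(γ)` is the subgroup of units of `D` lying in `K[γ]` (Mathlib
`Submonoid.units`). [cite: Gelbart1975, Remark 9.23] -/
theorem Subgroup.centralizer_units_singleton_eq (hD : ∀ x : D, x ≠ 0 → IsUnit x)
    (h4 : finrank K D = 4) {γ : Dˣ} (hγ : (γ : D) ∉ (⊥ : Subalgebra K D)) :
    Subgroup.centralizer ({γ} : Set Dˣ) = (Algebra.adjoin K {(γ : D)}).toSubmonoid.units := by
  haveI : Nontrivial D := Module.nontrivial_of_finrank_pos (R := K) (by omega)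
  haveI : FiniteDimensional K D := Module.finite_of_finrank_pos (by omega)
  ext g
  rw [Subgroup.mem_centralizer_iff, Submonoid.mem_units_iff]
  simp only [Set.mem_singleton_iff, forall_eq]
  constructor
  · intro h
    have hg : (g : D) ∈ Subalgebra.centralizer K ({(γ : D)} : Set D) := by
      rw [Subalgebra.mem_centralizer_iff]
      intro d hd
      rw [Set.mem_singleton_iff] at hd
      subst hd
      exact_mod_cast h
    rw [Subalgebra.centralizer_singleton_eq_adjoin hD h4 hγ] at hg
    exact ⟨hg, inv_mem_adjoin_singleton (K := K) hD _ hg⟩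
  · rintro ⟨hg, -⟩
    have hg' : (g : D) ∈ Subalgebra.centralizer K ({(γ : D)} : Set D) := by
      rw [Subalgebra.centralizer_singleton_eq_adjoin hD h4 hγ]
      exact hg
    rw [Subalgebra.mem_centralizer_iff] at hg'
    exact Units.ext (hg' _ rfl)

end Centralizer

end Literature.NumberTheory.Automorphic
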